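import Literature.NumberTheory.Automorphic.AutomorphicInductionCuspidalUnramifiedProofs
import Literature.NumberTheory.Automorphic.AutomorphicInductionCuspidalProofs
import Summits.Langlands.Langlands.Theses.QuadraticWindow
import HarnessLib

/-!
# Sketch — crux `QuadraticWindow.AutomorphicInductionUnramified` (stmt-Langlands-15138), ideator 1

First checkable statements of the two idea cards (crux-ideate round 1):

* `s-threaded-comparison`: `DescentOfGalOrbitOffS` (Arthur–Clozel Ch. 3 Thm. 4.2 (e) read with
  the spherical set `S` of the comparison (4.1) = (4.2) THREADED through, PDF chunks p0174–p0180 of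
  the held copy) and the statement that it yields the residual leaf `h51` of
  `automorphicInduction_cyclic_cuspidal_unramified_of_strongLifting_galOrbit`.
* `level-from-functional-equation`: the combinatorial core `coverage_rigidity` of the analytic
  line (two functional equations + stability under highly ramified twists force the local factor
  at `v₀` to be the induced Euler factor).
-/

noncomputable section

open scoped Classical
open NumberField IsDedekindDomain MeasureTheory Filter
open Literature.NumberTheory.Automorphic Literature.NumberTheory.Automorphic.AdelicGroupData
open Literature.NumberTheory.GaloisRepresentations (HeckeCharacter)

namespace Summit.Langlands.Langlands.Cruxes.AutomorphicInductionUnramified.SketchIdeator1Pub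

/-- The crux is literally the Literature named fact (sanity, `Iff.rfl`). -/
example : Summit.Langlands.Langlands.Theses.QuadraticWindow.AutomorphicInductionUnramified ↔
    automorphicInduction_cyclic_cuspidal_unramified := Iff.rfl

/-! ## Card `s-threaded-comparison` -/

/-- **Arthur–Clozel, Ch. 3, Thm. 4.2 (e) with the spherical set threaded** (`S`-controlled
descent of the Galois orbit, `L²` model, level of (1.1)).  For `E/F` cyclic of prime degree with
class-field character `η`, `Q₁` cuspidal on `GL_m(𝔸_E)` not `Gal`-stable, and ANY finite set `S`
of finite places of `F` containing the places ramified in `E` such that every conjugate `Q₁^σ`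
has a Satake family `A σ` off `S_E = {w : w|_F ∈ S}`: in every automorphic `L²` space over `F`
there is a cuspidal `P` on `GL_{ℓ m}(𝔸_F)`, lifted by the orbit in the weak sense, with
`P ⊗ η = P`, which has a Satake family `α` off THE SAME `S` with `∑_σ A σ w = α(v)^{f(w|v)}` at
every `w ∉ S_E` — what the identity (4.1) = (4.2) for `f = bφ` spherical outside `S` and the linear
independence of characters of `𝓗_E^S` deliver (PDF chunks p0174–p0175, p0179; Thm. I.4.5). -/
def DescentOfGalOrbitOffS (F E : Type) [Field F] [NumberField F] [Field E] [NumberField E]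
    [Algebra F E] (m : ℕ) : Prop :=
  ∀ [IsGalois F E] (_hm : 0 < m) (_hℓ : (Module.finrank F E).Prime) (η : HeckeCharacter F)
    (hη : η.IsClassFieldCharacter E)
    (ν : Measure (gl m E).automorphicQuotient) [(gl m E).IsAutomorphicMeasure ν]
    (_hm1 : multiplicity_one_gl m E ν) (hν : IsGalInvariant F ν) (Q₁ : CuspidalAutomorphicRepGL m E ν)
    (_hQ : ∃ σ : E ≃ₐ[F] E, ¬ Q₁.IsGalStable F hν σ)
    (S : Set (HeightOneSpectrum (𝓞 F))) (A : (E ≃ₐ[F] E) → SatakeFamily E),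
    S.Finite → {v : HeightOneSpectrum (𝓞 F) | ¬ Algebra.IsUnramifiedIn (𝓞 E) v.asIdeal} ⊆ S →
    (∀ σ : E ≃ₐ[F] E, IsSatakeFamilyOf (Q₁.galConj F hν σ) {w | w.under (𝓞 F) ∈ S} (A σ)) →
    ∀ (μ : Measure (gl (Module.finrank F E * m) F).automorphicQuotient)
      [(gl (Module.finrank F E * m) F).IsAutomorphicMeasure μ],
    ∃ (P : CuspidalAutomorphicRepGL (Module.finrank F E * m) F μ) (α : SatakeFamily F),
      IsWeakBaseChangeLiftOfGalOrbit P.1 Q₁ hν ∧ P.twistByFiniteOrderChar η hη.isFiniteOrder = P ∧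
      IsSatakeFamilyOf P S α ∧
      ∀ w : HeightOneSpectrum (𝓞 E), w.under (𝓞 F) ∉ S →
        ∑ σ : E ≃ₐ[F] E, A σ w = (α (w.under (𝓞 F))).map (· ^ w.asIdeal.inertiaDeg (𝓞 F))

/-- The residual leaf `h51` of the landed reduction
`automorphicInduction_cyclic_cuspidal_unramified_of_strongLifting_galOrbit`, verbatim. -/
def H51 : Prop :=
  ∀ (n : ℕ) (F E : Type) [Field F] [NumberField F] [Field E] [NumberField E] [Algebra F E]
    [IsGalois F E], (Module.finrank F E).Prime → 0 < n →
    ∀ (μ : Measure (gl (Module.finrank F E * n) F).automorphicQuotient)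
      [(gl (Module.finrank F E * n) F).IsAutomorphicMeasure μ]
      (ν : Measure (gl n E).automorphicQuotient) [(gl n E).IsAutomorphicMeasure ν]
      (hν : IsGalInvariant F ν) (P : CuspidalAutomorphicRepGL (Module.finrank F E * n) F μ)
      (Q₁ : CuspidalAutomorphicRepGL n E ν), IsWeakBaseChangeLiftOfGalOrbit P.1 Q₁ hν →
      ∀ (v : HeightOneSpectrum (𝓞 F)) (w : HeightOneSpectrum (𝓞 E)),
        w.asIdeal.under (𝓞 F) = v.asIdeal → v.asIdeal.ramificationIdxIn (𝓞 E) = 1 →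
        ∀ β : (E ≃ₐ[F] E) → Multiset ℂ,
          (∀ σ : E ≃ₐ[F] E, ∃ (𝔑 : Ideal (𝓞 E)) (ϖ' : ((σ⁻¹ • w).adicCompletion E)ˣ),
            𝔑 ≠ 0 ∧ ¬ (σ⁻¹ • w).asIdeal ∣ 𝔑 ∧
              HasSatakeParameterAt Q₁.1 (principalCongruenceLevel n E 𝔑) (σ⁻¹ • w) ϖ' (β σ)) →
          ∃ (𝔫 : Ideal (𝓞 F)) (ϖ : (v.adicCompletion F)ˣ) (α : Multiset ℂ),
            𝔫 ≠ 0 ∧ ¬ v.asIdeal ∣ 𝔫 ∧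
              HasSatakeParameterAt P.1 (principalCongruenceLevel (Module.finrank F E * n) F 𝔫) v ϖ α ∧
              ∑ σ : E ≃ₐ[F] E, β σ = α.map (· ^ w.asIdeal.inertiaDeg (𝓞 F))

/-- `H51'`: the same leaf with the harmless extra hypothesis "`Q₁` is not `Gal`-stable", which
is available at the only call site of `h51` in the landed reduction (`hnst`, obtained from
`¬ IsGaloisStableSatakeAE` via `isGaloisStableSatakeAE_of_forall_isGalStable`).  With it the
`S`-threaded descent applies directly; without it one must first show the hypothesis of `H51` is
vacuous for `Gal`-stable `Q₁` (Thm. 4.2 (a)–(b) + Jacquet–Shalika: a cuspidal `P` is never lifted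
by `ℓ` copies of one cuspidal `Q₁`), which costs two more named leaves. -/
def H51' : Prop :=
  ∀ (n : ℕ) (F E : Type) [Field F] [NumberField F] [Field E] [NumberField E] [Algebra F E]
    [IsGalois F E], (Module.finrank F E).Prime → 0 < n →
    ∀ (μ : Measure (gl (Module.finrank F E * n) F).automorphicQuotient)
      [(gl (Module.finrank F E * n) F).IsAutomorphicMeasure μ]
      (ν : Measure (gl n E).automorphicQuotient) [(gl n E).IsAutomorphicMeasure ν]
      (hν : IsGalInvariant F ν) (P : CuspidalAutomorphicRepGL (Module.finrank F E * n) F μ)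
      (Q₁ : CuspidalAutomorphicRepGL n E ν), (∃ σ : E ≃ₐ[F] E, ¬ Q₁.IsGalStable F hν σ) →
      IsWeakBaseChangeLiftOfGalOrbit P.1 Q₁ hν →
      ∀ (v : HeightOneSpectrum (𝓞 F)) (w : HeightOneSpectrum (𝓞 E)),
        w.asIdeal.under (𝓞 F) = v.asIdeal → v.asIdeal.ramificationIdxIn (𝓞 E) = 1 →
        ∀ β : (E ≃ₐ[F] E) → Multiset ℂ,
          (∀ σ : E ≃ₐ[F] E, ∃ (𝔑 : Ideal (𝓞 E)) (ϖ' : ((σ⁻¹ • w).adicCompletion E)ˣ),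
            𝔑 ≠ 0 ∧ ¬ (σ⁻¹ • w).asIdeal ∣ 𝔑 ∧
              HasSatakeParameterAt Q₁.1 (principalCongruenceLevel n E 𝔑) (σ⁻¹ • w) ϖ' (β σ)) →
          ∃ (𝔫 : Ideal (𝓞 F)) (ϖ : (v.adicCompletion F)ˣ) (α : Multiset ℂ),
            𝔫 ≠ 0 ∧ ¬ v.asIdeal ∣ 𝔫 ∧
              HasSatakeParameterAt P.1 (principalCongruenceLevel (Module.finrank F E * n) F 𝔫) v ϖ α ∧
              ∑ σ : E ≃ₐ[F] E, β σ = α.map (· ^ w.asIdeal.inertiaDeg (𝓞 F))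

/-- **First lemma of the line `s-threaded-comparison`.**  The `S`-threaded descent gives the
residual leaf in the form `H51'`: at a given `v` unramified in `E` take
`S := Ram(E/F) ∪ {u ≠ v : some conjugate of Q₁ is ramified somewhere above u}` (finite by
`exists_isSatakeFamilyOf_holds`), descend off `S` in the same `L²` space `μ`, identify the output
with `P` by the uniqueness clause of Thm. 4.2 (e) (`ArthurClozel1989_descent_of_galOrbit`,
multiplicity one and the class field character `exists_isClassFieldCharacter_holds`), and read off
the relation at `v ∉ S` (`Flath1979_heckeOperatorAt_ofLocal_eq_smul_holds` for the uniqueness of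
`L²` Satake parameters). -/
theorem h51'_of_descentOfGalOrbitOffS
    (hS : ∀ (F E : Type) [Field F] [NumberField F] [Field E] [NumberField E] [Algebra F E]
      (m : ℕ), DescentOfGalOrbitOffS F E m)
    (h42e : ∀ (F E : Type) [Field F] [NumberField F] [Field E] [NumberField E] [Algebra F E]
      [FiniteDimensional F E] (m : ℕ), ArthurClozel1989_descent_of_galOrbit F E m)
    (hm1 : ∀ (n : ℕ) (K : Type) [Field K] [NumberField K] (μ : Measure (gl n K).automorphicQuotient)
      [(gl n K).IsAutomorphicMeasure μ], multiplicity_one_gl n K μ) :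
    H51' := by
  sorry

/-- The landed reduction re-run with `H51'` for `h51` (its proof is that of
`automorphicInduction_cyclic_cuspidal_unramified_of_strongLifting_galOrbit_of_iff_L2` verbatim,
passing `hnst` at the one call of `h51`; ~110 lines to copy in the skeleton). -/
theorem crux_of_h51'
    (h42e : ∀ (F E : Type) [Field F] [NumberField F] [Field E] [NumberField E] [Algebra F E]
      [FiniteDimensional F E] (m : ℕ), ArthurClozel1989_descent_of_galOrbit F E m)
    (hm1 : ∀ (n : ℕ) (K : Type) [Field K] [NumberField K] (μ : Measure (gl n K).automorphicQuotient)
      [(gl n K).IsAutomorphicMeasure μ], multiplicity_one_gl n K μ)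
    (hL2 : ∀ {n : ℕ} {K : Type} [Field K] [NumberField K] (hK : isCompact_glFiniteIntegralLevel n K)
      (μ : Measure (gl n K).automorphicQuotient) [(gl n K).IsAutomorphicMeasure μ],
      hasSatakeParamAt_iff_L2 hK μ)
    (h51 : H51') :
    Summit.Langlands.Langlands.Theses.QuadraticWindow.AutomorphicInductionUnramified := by
  sorry

/-- … hence the crux from the ONE new leaf `hS` (plus the two named leaves of the a.e. fact and the
discharged dictionary `hasSatakeParamAt_iff_L2_holds`); `h42e` is the weak shadow of `hS`. -/
theorem crux_of_descentOfGalOrbitOffS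
    (hS : ∀ (F E : Type) [Field F] [NumberField F] [Field E] [NumberField E] [Algebra F E]
      (m : ℕ), DescentOfGalOrbitOffS F E m)
    (h42e : ∀ (F E : Type) [Field F] [NumberField F] [Field E] [NumberField E] [Algebra F E]
      [FiniteDimensional F E] (m : ℕ), ArthurClozel1989_descent_of_galOrbit F E m)
    (hm1 : ∀ (n : ℕ) (K : Type) [Field K] [NumberField K] (μ : Measure (gl n K).automorphicQuotient)
      [(gl n K).IsAutomorphicMeasure μ], multiplicity_one_gl n K μ)
    (hL2 : ∀ {n : ℕ} {K : Type} [Field K] [NumberField K] (hK : isCompact_glFiniteIntegralLevel n K)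
      (μ : Measure (gl n K).automorphicQuotient) [(gl n K).IsAutomorphicMeasure μ],
      hasSatakeParamAt_iff_L2 hK μ) :
    Summit.Langlands.Langlands.Theses.QuadraticWindow.AutomorphicInductionUnramified :=
  crux_of_h51' h42e hm1 hL2 (h51'_of_descentOfGalOrbitOffS hS h42e hm1)

/-- If one insists on the verbatim leaf `H51` (no non-stability hypothesis), the landed theorem
`automorphicInduction_cyclic_cuspidal_unramified_of_strongLifting_galOrbit_of_iff_L2` (module
`AutomorphicInductionCuspidalUnramifiedStrongLifting`, landed 2026-08-16 08:40Z; not imported in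
this PUBLISHED copy only because the farm build of that module was incoherent at publication time —
the evidence copy `Sketch.lean` on the item imports it and proves this corollary outright) applies
as it stands, entered here as the hypothesis `hred`; the `Gal`-stable case of `H51` is then vacuous
but costs Thm. 4.2 (a)–(b). -/
theorem crux_of_h51
    (hred : (∀ (F E : Type) [Field F] [NumberField F] [Field E] [NumberField E] [Algebra F E]
      [FiniteDimensional F E] (m : ℕ), ArthurClozel1989_descent_of_galOrbit F E m) →
      (∀ (n : ℕ) (K : Type) [Field K] [NumberField K] (μ : Measure (gl n K).automorphicQuotient)
        [(gl n K).IsAutomorphicMeasure μ], multiplicity_one_gl n K μ) →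
      (∀ {n : ℕ} {K : Type} [Field K] [NumberField K] (hK : isCompact_glFiniteIntegralLevel n K)
        (μ : Measure (gl n K).automorphicQuotient) [(gl n K).IsAutomorphicMeasure μ],
        hasSatakeParamAt_iff_L2 hK μ) → H51 → automorphicInduction_cyclic_cuspidal_unramified)
    (h42e : ∀ (F E : Type) [Field F] [NumberField F] [Field E] [NumberField E] [Algebra F E]
      [FiniteDimensional F E] (m : ℕ), ArthurClozel1989_descent_of_galOrbit F E m)
    (hm1 : ∀ (n : ℕ) (K : Type) [Field K] [NumberField K] (μ : Measure (gl n K).automorphicQuotient)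
      [(gl n K).IsAutomorphicMeasure μ], multiplicity_one_gl n K μ)
    (hL2 : ∀ {n : ℕ} {K : Type} [Field K] [NumberField K] (hK : isCompact_glFiniteIntegralLevel n K)
      (μ : Measure (gl n K).automorphicQuotient) [(gl n K).IsAutomorphicMeasure μ],
      hasSatakeParamAt_iff_L2 hK μ)
    (h51 : H51) :
    Summit.Langlands.Langlands.Theses.QuadraticWindow.AutomorphicInductionUnramified :=
  hred h42e hm1 hL2 h51

/-! ## Card `level-from-functional-equation` -/

/-- **First lemma of the line `level-from-functional-equation` (the combinatorial core).**
After the two functional equations and the stable highly-ramified twist have isolated the place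
`v₀`, one is left with an identity of Euler polynomials in `T = q^{-s}` up to a monomial:
`T^e ∏_{(b,k) ∈ B} (1 - b T) · ∏_{a ∈ A} (1 - q a T) = C T^m ∏_{a ∈ A} (1 - a T) · ∏_{(b,k) ∈ B} (1 - q^k b T)`,
where `A` is the induced Satake parameter (Jacquet–Shalika flat: no two entries differ by a
positive power of `q`) and `B` lists the inverse roots `b` of `L(s, P_{v₀})⁻¹` with the lengths
`k ≥ 1` of their segments (so that `L(s, P̃_{v₀})⁻¹ = ∏ (1 - q^{k-1} b⁻¹ T)`).  Read on inverse
roots the identity is the multiset equation below, and it forces every segment to have length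
`1` and `B = A`: per `q^ℤ`-coset the "coverage function" of the intervals `[t_j, t_j + k_j)` has
the same discrete derivative as `m · 𝟙_{t_c}`.  Pure multiset algebra (no analysis); in the line it
is applied with `q ↦ q_{v₀}⁻¹` to the inverse parameters, whence the hypothesis `‖q‖ ≠ 1`. -/
theorem coverage_rigidity {q : ℂ} (hq : ‖q‖ ≠ 1) (A : Multiset ℂ) (B : Multiset (ℂ × ℕ))
    (hA0 : (0 : ℂ) ∉ A) (hB : ∀ p ∈ B, p.1 ≠ 0 ∧ 0 < p.2)
    (hflat : ∀ x ∈ A, ∀ t : ℕ, x * q ^ (t + 1) ∉ A)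
    (h : B.map Prod.fst + A.map (q * ·) = A + B.map (fun p => q ^ p.2 * p.1)) :
    B.map Prod.fst = A ∧ ∀ p ∈ B, p.2 = 1 := by
  sorry

/-- The special case without segments (`k ≡ 1`, i.e. both sides generic with length-one
segments) is the bare "`D = q_* D ⇒ D = 0`" statement: a finitely supported function on `ℂˣ`
invariant under push-forward by multiplication by `q`, `‖q‖ ≠ 1`, vanishes (look at an element of
extremal norm in its support).  No flatness needed. -/
theorem multiset_eq_of_add_map_mul_eq {q : ℂ} (hq : ‖q‖ ≠ 1) (A B : Multiset ℂ)
    (h0 : (0 : ℂ) ∉ A + B) (h : B + A.map (q * ·) = A + B.map (q * ·)) : B = A := by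
  sorry

end Summit.Langlands.Langlands.Cruxes.AutomorphicInductionUnramified.SketchIdeator1Pub

end
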